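import Mathlib
import Summits.Parity.BatemanHorn.Theorems.IsogenyRedeiPolyMobiusTailStubEventuallyTwoLe
import Summits.Parity.BatemanHorn.Theorems.IsogenyRedeiPolyMobiusTailStubSignedTypeIOfKernel
import Summits.Parity.BatemanHorn.Theorems.IsogenyRedeiPolyMobiusTailStubPointwise
import Summits.Parity.BatemanHorn.Theorems.IsogenyRedeiPolyMobiusTailKernelTwoLe

/-!
# Crux `PolyMobiusTail` (stmt-Parity-0870), line `Sketch`: bridge 1 for every `k`

Lead prover `prover-line-stmt-Parity-0870-c1-0`.  Bridge 1 of line `Sketch` as a theorem for EVERY `k`: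
for a Bateman–Horn system and `η ∈ (1/2, 1)`,
`Σ_{n≤x} ((-1)^k · routeTail(n, x^{1-η}) − naturalTail(n, x^{1-η})) = o(x)`,
from the landed pointwise `S`-expansion (`stub_pointwise`), the eventual size of the values
(`stub_eventually_two_le`) and the signed Type-I sums (`stub_signedTypeI_of_kernel` over the kernel for every
`k`, `KernelTwoLe.kernel_of_stubs`).
Head: the registered auxiliary stub `stub_routeTailToNaturalTail`. Everything here is proved. [folklore]
-/

open scoped BigOperators
open Filter Finset Polynomial Asymptotics

namespace Summit.Parity.BatemanHorn.Theorems.PolyMobiusTail.NaturalForm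

open Literature.NumberTheory.Sieve

namespace Reduction

/-- Abstract form of the assembly of bridge 1: if `D n y` vanishes once `y ≥ M n`, expands for
`n ≥ N` as `Σ_{s∈T} c_s · U_s(n,y)`, each `U_s(n,·)` is bounded, and each `Σ_{n≤x} U_s(n, g x) = o(x)`
with `g → ∞`, then `Σ_{n≤x} D(n, g x) = o(x)`. -/
theorem isLittleO_sum_of_expansion {σ : Type*} (T : Finset σ) (c : σ → ℝ) (D : ℕ → ℝ → ℝ)
    (U : σ → ℕ → ℝ → ℝ) (M : ℕ → ℝ) (g : ℕ → ℝ) (N : ℕ)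
    (h0 : ∀ n y, M n ≤ y → D n y = 0)
    (h1 : ∀ n y, N ≤ n → D n y = ∑ s ∈ T, c s * U s n y)
    (h2 : ∀ s ∈ T, ∀ n, ∃ B, ∀ y, |U s n y| ≤ B)
    (h3 : ∀ s ∈ T, (fun x : ℕ => ∑ n ∈ Finset.Icc 1 x, U s n (g x)) =o[atTop] fun x : ℕ => (x : ℝ))
    (hg : Tendsto g atTop atTop) :
    (fun x : ℕ => ∑ n ∈ Finset.Icc 1 x, D n (g x)) =o[atTop] fun x : ℕ => (x : ℝ) := by
  choose! B hB using h2
  -- the eventual identity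
  have key : ∀ᶠ x : ℕ in atTop, (∑ s ∈ T, c s * ((∑ n ∈ Finset.Icc 1 x, U s n (g x))
      - ∑ n ∈ (Finset.Icc 1 x).filter (fun n => n < N), U s n (g x)))
        = ∑ n ∈ Finset.Icc 1 x, D n (g x) := by
    filter_upwards [hg.eventually_ge_atTop (∑ n ∈ Finset.range N, |M n|)] with x hx
    rw [← Finset.sum_filter_add_sum_filter_not (Finset.Icc 1 x) (fun n => n < N) (fun n => D n (g x))]
    have hA : ∑ n ∈ (Finset.Icc 1 x).filter (fun n => n < N), D n (g x) = 0 := by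
      refine Finset.sum_eq_zero fun n hn => h0 _ _ ?_
      have hn' : n < N := (Finset.mem_filter.1 hn).2
      calc M n ≤ |M n| := le_abs_self _
        _ ≤ ∑ n ∈ Finset.range N, |M n| :=
            Finset.single_le_sum (f := fun n => |M n|) (fun _ _ => abs_nonneg _)
              (Finset.mem_range.2 hn')
        _ ≤ g x := hx
    have hB' : ∑ n ∈ (Finset.Icc 1 x).filter (fun n => ¬ n < N), D n (g x)
        = ∑ s ∈ T, c s * ∑ n ∈ (Finset.Icc 1 x).filter (fun n => ¬ n < N), U s n (g x) := by
      rw [Finset.sum_congr rfl (fun n hn => h1 n (g x) (not_lt.1 (Finset.mem_filter.1 hn).2)),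
        Finset.sum_comm]
      simp only [Finset.mul_sum]
    have hC : ∀ s, ∑ n ∈ (Finset.Icc 1 x).filter (fun n => ¬ n < N), U s n (g x)
        = ∑ n ∈ Finset.Icc 1 x, U s n (g x)
          - ∑ n ∈ (Finset.Icc 1 x).filter (fun n => n < N), U s n (g x) := by
      intro s
      have := Finset.sum_filter_add_sum_filter_not (Finset.Icc 1 x) (fun n => n < N)
        (fun n => U s n (g x))
      linarith
    rw [hA, zero_add, hB']
    exact Finset.sum_congr rfl fun s _ => by rw [hC]
  refine IsLittleO.congr' ?_ key EventuallyEq.rfl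
  refine IsLittleO.sum fun s hs => IsLittleO.const_mul_left ((h3 s hs).sub ?_) _
  -- the initial segment is bounded, hence `o(x)`
  have hbound : ∀ x : ℕ, |∑ n ∈ (Finset.Icc 1 x).filter (fun n => n < N), U s n (g x)|
      ≤ ∑ n ∈ Finset.range N, B s n := by
    intro x
    refine (Finset.abs_sum_le_sum_abs _ _).trans ?_
    refine (Finset.sum_le_sum fun n _ => hB s hs n (g x)).trans ?_
    refine Finset.sum_le_sum_of_subset_of_nonneg ?_ fun n _ _ => (abs_nonneg _).trans (hB s hs n (g 0))
    intro n hn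
    exact Finset.mem_range.2 (Finset.mem_filter.1 hn).2
  have h1' : (fun x : ℕ => ∑ n ∈ (Finset.Icc 1 x).filter (fun n => n < N), U s n (g x))
      =O[atTop] fun _ : ℕ => (1 : ℝ) := by
    refine IsBigO.of_bound (∑ n ∈ Finset.range N, B s n) (Eventually.of_forall fun x => ?_)
    rw [Real.norm_eq_abs, norm_one, mul_one]
    exact hbound x
  refine h1'.trans_isLittleO ?_
  refine isLittleO_const_left.2 (Or.inr ?_)
  exact tendsto_norm_atTop_atTop.comp tendsto_natCast_atTop_atTop

/-- For a divisor tuple `d` of the values, `∏ dᵢ ≤ ∏ fᵢ(n).toNat` (as reals). -/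
theorem prod_cast_le_of_mem_piFinset {k : ℕ} (m : Fin k → ℕ) {d : Fin k → ℕ}
    (hd : d ∈ Fintype.piFinset fun i => (m i).divisors) :
    ∏ i, (d i : ℝ) ≤ ∏ i, (m i : ℝ) :=
  Finset.prod_le_prod (fun _ _ => Nat.cast_nonneg _)
    fun i _ => Nat.cast_le.2 (Nat.divisor_le (Fintype.mem_piFinset.1 hd i))

/-- Bridge 1 of the card for `η ∈ (1/2, 1)`, from stubs 1–3: at the common cut-off `x^{1-η}`,
`Σ_{n≤x} ((-1)^k·routeTail − naturalTail) = o(x)`. -/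
theorem routeTailToNaturalTail_of_stubs : ∀ (k : ℕ) (f : Fin k → ℤ[X]),
    Literature.NumberTheory.Sieve.IsBatemanHornSystem f → ∀ η : ℝ, 1 / 2 < η → η < 1 →
      (fun x : ℕ => ∑ n ∈ Finset.Icc 1 x,
        ((-1 : ℝ) ^ k * (∑ d ∈ Fintype.piFinset (fun i => (((f i).eval (n : ℤ)).toNat).divisors),
            if (x : ℝ) ^ (1 - η) < ∏ i, (d i : ℝ) then
              ∏ i, ((ArithmeticFunction.moebius (d i) : ℝ) * Real.log (d i)) else 0)
          - (∑ d ∈ Fintype.piFinset (fun i => (((f i).eval (n : ℤ)).toNat).divisors),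
            if (x : ℝ) ^ (1 - η) < ∏ i, (d i : ℝ) then
              ∏ i, ((ArithmeticFunction.moebius (d i) : ℝ) *
                Real.log ((((f i).eval (n : ℤ)).toNat : ℝ) / (d i : ℝ))) else 0)))
        =o[atTop] fun x : ℕ => (x : ℝ) := by
  intro k f hf η hη hη1
  obtain ⟨N, hN⟩ := stub_eventually_two_le k f hf
  refine isLittleO_sum_of_expansion
    ((Finset.univ : Finset (Fin k)).powerset.filter (fun S => S.Nonempty))
    (fun S => (-1 : ℝ) ^ (Finset.univ \ S).card)
    (fun n y => (-1 : ℝ) ^ k * (∑ d ∈ Fintype.piFinset (fun i => (((f i).eval (n : ℤ)).toNat).divisors),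
        if y < ∏ i, (d i : ℝ) then ∏ i, ((ArithmeticFunction.moebius (d i) : ℝ) * Real.log (d i)) else 0)
      - (∑ d ∈ Fintype.piFinset (fun i => (((f i).eval (n : ℤ)).toNat).divisors),
        if y < ∏ i, (d i : ℝ) then
          ∏ i, ((ArithmeticFunction.moebius (d i) : ℝ) *
            Real.log ((((f i).eval (n : ℤ)).toNat : ℝ) / (d i : ℝ))) else 0))
    (fun S n y => (∏ i ∈ S, Real.log ((((f i).eval (n : ℤ)).toNat : ℝ))) *
      ∑ d ∈ Fintype.piFinset (fun i => (((f i).eval (n : ℤ)).toNat).divisors),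
        if ∏ i, (d i : ℝ) ≤ y then
          (∏ i, (ArithmeticFunction.moebius (d i) : ℝ)) * ∏ i ∈ Finset.univ \ S, Real.log (d i)
        else 0)
    (fun n => ∏ i, ((((f i).eval (n : ℤ)).toNat : ℕ) : ℝ))
    (fun x : ℕ => (x : ℝ) ^ (1 - η)) N ?_ ?_ ?_ ?_ ?_
  · -- h0: beyond `∏ fᵢ(n)` both tails are empty
    intro n y hy
    have hR : (∑ d ∈ Fintype.piFinset (fun i => (((f i).eval (n : ℤ)).toNat).divisors),
        if y < ∏ i, (d i : ℝ) then ∏ i, ((ArithmeticFunction.moebius (d i) : ℝ) * Real.log (d i)) else 0)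
        = 0 :=
      Finset.sum_eq_zero fun d hd => if_neg (not_lt.2 ((prod_cast_le_of_mem_piFinset _ hd).trans hy))
    have hA : (∑ d ∈ Fintype.piFinset (fun i => (((f i).eval (n : ℤ)).toNat).divisors),
        if y < ∏ i, (d i : ℝ) then
          ∏ i, ((ArithmeticFunction.moebius (d i) : ℝ) *
            Real.log ((((f i).eval (n : ℤ)).toNat : ℝ) / (d i : ℝ))) else 0) = 0 :=
      Finset.sum_eq_zero fun d hd => if_neg (not_lt.2 ((prod_cast_le_of_mem_piFinset _ hd).trans hy))
    simp only [hR, hA, mul_zero, sub_zero]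
  · -- h1: the pointwise expansion (stub 1) for `n ≥ N` (no value equals `1` by stub 2)
    intro n y hn
    have h := stub_pointwise k f y n (fun i => by have := hN n hn i; omega)
    simp only [h]
    exact Finset.sum_congr rfl fun S _ => mul_assoc _ _ _
  · -- h2: each `U_S(n, ·)` is bounded (by `|∏ log fᵢ(n)| · Σ_d |weight|`)
    intro S _ n
    refine ⟨|∏ i ∈ S, Real.log ((((f i).eval (n : ℤ)).toNat : ℝ))| *
      ∑ d ∈ Fintype.piFinset (fun i => (((f i).eval (n : ℤ)).toNat).divisors),
        |(∏ i, (ArithmeticFunction.moebius (d i) : ℝ)) * ∏ i ∈ Finset.univ \ S, Real.log (d i)|,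
      fun y => ?_⟩
    rw [abs_mul]
    refine mul_le_mul_of_nonneg_left ?_ (abs_nonneg _)
    refine (Finset.abs_sum_le_sum_abs _ _).trans (Finset.sum_le_sum fun d _ => ?_)
    split_ifs
    · exact le_rfl
    · rw [abs_zero]; exact abs_nonneg _
  · -- h3: stub 3
    intro S hS
    exact stub_signedTypeI_of_kernel KernelTwoLe.kernel_of_stubs k f hf η hη hη1 S (Finset.mem_filter.1 hS).2
  · exact (tendsto_rpow_atTop (by linarith)).comp tendsto_natCast_atTop_atTop

end Reduction

/-- **Stub `stub_routeTailToNaturalTail`** (registered auxiliary stub of line `Sketch`, the head of this file):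
bridge 1 for every `k` — for a Bateman–Horn system and `η ∈ (1/2, 1)`, at the common cut-off `x^{1-η}`,
`Σ_{n≤x} ((-1)^k·routeTail − naturalTail) = o(x)`. [folklore] -/
theorem stub_routeTailToNaturalTail : ∀ (k : ℕ) (f : Fin k → ℤ[X]),
    Literature.NumberTheory.Sieve.IsBatemanHornSystem f → ∀ η : ℝ, 1 / 2 < η → η < 1 →
      (fun x : ℕ => ∑ n ∈ Finset.Icc 1 x,
        ((-1 : ℝ) ^ k * (∑ d ∈ Fintype.piFinset (fun i => (((f i).eval (n : ℤ)).toNat).divisors),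
            if (x : ℝ) ^ (1 - η) < ∏ i, (d i : ℝ) then
              ∏ i, ((ArithmeticFunction.moebius (d i) : ℝ) * Real.log (d i)) else 0)
          - (∑ d ∈ Fintype.piFinset (fun i => (((f i).eval (n : ℤ)).toNat).divisors),
            if (x : ℝ) ^ (1 - η) < ∏ i, (d i : ℝ) then
              ∏ i, ((ArithmeticFunction.moebius (d i) : ℝ) *
                Real.log ((((f i).eval (n : ℤ)).toNat : ℝ) / (d i : ℝ))) else 0)))
        =o[atTop] fun x : ℕ => (x : ℝ) :=
  Reduction.routeTailToNaturalTail_of_stubs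

end Summit.Parity.BatemanHorn.Theorems.PolyMobiusTail.NaturalForm
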